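import Summits.NavierStokesRegularity.NavierStokesRegularity.Theorems.ScenarioCensusGeneratorMeterRank
import HarnessLib

/-!
# GENERATOR METER port, part 4/4: §I controls; §J the census rows in (L′)-shape (`Row_A2gnS` / `Row_A2gn0` / `Row_A2gnP` / `Row_A2gnTf` / `Row_A2gn2` DECIDED, `Row_A2gnE` / `Row_A2gnT` OPEN), fed BY NAME by
# the rung (`rows_of_L'`, `rows_of_rung`); census KEYS

Re-homed for the scenario census (typer seat ns-census-typer-1 g10; the cells A2gnS / A2gn0 / A2gnP / A2gnTf / A2gn2 are MEMBERS OF RECORD «DECIDED IN KERNEL IN FILES» of row A2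
(item 84: critic idea-crit-3 g10 PASS 12:19:42Z; ref PRE-CHECK ✓ §19.13; lead label Pineau–Vicol arXiv:2607.09619 Thm 1.9), A2gnE / A2gnT OPEN (typed); this port makes the decided cells
TREE-decided): VERBATIM PORT of ns-idea-2 LINE g17-3 «generator-meter», `pub/ideators/ns-idea-2/lines/generator-meter/line-generator-meter.lean` sha16 71227eedda12bed6 (934 l.,
lean check rc 0, 0 sorry), split for the 400-line rule into `ScenarioCensusGeneratorMeter` (§A–§C) → `…GeneratorMeterScaling` (§D–§F) → `…GeneratorMeterRank` (§F′–§G) →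
`…GeneratorMeterRows` (§I–§J + census KEYS).  Lean text VERBATIM in namespace `…Theorems.ScenarioCensus.GeneratorMeter` (the line's `…Lines.GeneratorMeter` re-homed); port
edits: the line's `local notation "E3"` is spelled as the reducible `abbrev E3` of every census file; `@[conjecture]` on the OPEN rows `Row_A2gnE`, `Row_A2gnT`; one-line docstrings
added where missing (gate lint).  Statements untouched.

No census VALUE is moved here (row A2 stays OPEN-WITH-LINE; the members become TREE-decided by name); (L′) is NOT proved; no summit statement is proved by this file.
-/

-- the summit and its single problem share the name `NavierStokesRegularity` (D-0017 nested layout)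
set_option linter.dupNamespace false

noncomputable section

open Set Function Filter Metric
open scoped Topology
open Literature.Analysis Literature.Analysis.FluidPDE
open Summit.NavierStokesRegularity.NavierStokesRegularity.Theorems

namespace Summit.NavierStokesRegularity.NavierStokesRegularity.Theorems.ScenarioCensus.GeneratorMeter

variable {C : ℝ} {u : ℝ → E3 → E3}

/-! ## I. Controls -/

/-- The Taylor extension of a slice `U` with prescribed time derivative `−κ⁻¹(DU[y] + U)`. -/
def taylorControl (U : E3 → E3) (κ t₁ : ℝ) : ℝ → E3 → E3 :=
  fun t y => U y + (t - t₁) • ((-κ⁻¹) • (fderiv ℝ U y y + U y))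

/-- **KINEMATIC CONTROL — the one-slice reading constrains nothing by itself.** ANY `C¹` slice `U`
extends to a space-time field whose scaling reading (centre `0`, normalised, any `κ ≠ 0`) vanishes
identically on the slice `t₁`: the Taylor extension `u(t, x) = U(x) + (t − t₁) V(x)` with
`V = −κ⁻¹ (DU[x] + U)` (`taylorControl`).  So the content of the decided cells is Navier–Stokes (the
profile dictionary) plus Tsai / the class, not the generator algebra. -/
theorem scalingReading_taylor_control (U : E3 → E3) {κ : ℝ} (hκ : κ ≠ 0) (t₁ : ℝ) (x : E3) :
    fderiv ℝ (taylorControl U κ t₁ t₁) x x + taylorControl U κ t₁ t₁ x +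
      κ • timeDeriv (taylorControl U κ t₁) t₁ x = 0 := by
  have hslice : taylorControl U κ t₁ t₁ = U := by funext y; simp [taylorControl]
  have htd : timeDeriv (taylorControl U κ t₁) t₁ x = (-κ⁻¹) • (fderiv ℝ U x x + U x) := by
    simp only [timeDeriv_apply, taylorControl]
    have h1 : HasDerivAt (fun t : ℝ => U x + (t - t₁) • ((-κ⁻¹) • (fderiv ℝ U x x + U x)))
        ((1 : ℝ) • ((-κ⁻¹) • (fderiv ℝ U x x + U x))) t₁ :=
      (((hasDerivAt_id t₁).sub_const t₁).smul_const _).const_add (U x)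
    rw [h1.deriv, one_smul]
  rw [hslice, htd, smul_smul, mul_neg, mul_inv_cancel₀ hκ, neg_smul, one_smul]
  abel

/-- Control: the reading of the zero generator is zero. -/
theorem genReading_zero_generator (u : ℝ → E3 → E3) (t : ℝ) (x : E3) :
    genReading 0 0 0 u t x = 0 := by
  simp [genReading]

/-- Control: a spatially constant nonzero slice `U ≡ w` is `a`-periodic for every `a` and is NOT killed
by line integration — what kills in § F is the class (census A13), not the calculus. -/
theorem const_slice_periodic (w a y : E3) : (fun _ : E3 => w) (y + a) = (fun _ : E3 => w) y := rfl

/-! ## J. Census rows in (L′)-shape, fed BY NAME by the rung -/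

/-- Row A2gnS — «the reading of a scaling generator whose vertex time lies in the FUTURE of the
measured slice vanishes on a germ of that slice» ⇒ `u ≡ 0`.  EXCLUDED — PROVED
(`eq_zero_of_genReading_future`: one-slice Tsai). -/
def Row_A2gnS : Prop :=
  ∀ (C : ℝ) (u : ℝ → E3 → E3), IsTypeIAncientMild C u →
    (∃ (a : E3) (σ τ t₁ : ℝ) (U : Set E3), t₁ < 0 ∧ σ ≠ 0 ∧ σ * (2 * σ * t₁ + τ) < 0 ∧
      IsOpen U ∧ U.Nonempty ∧ ∀ x ∈ U, genReading a σ τ u t₁ x = 0) →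
    ∀ t < 0, ∀ x, u t x = 0

/-- **Row A2gnS holds.** -/
theorem row_A2gnS : Row_A2gnS := by
  rintro C u hu ⟨a, σ, τ, t₁, U, ht₁, hσ, hfut, hU, hne, h⟩
  exact eq_zero_of_genReading_future hu ht₁ hσ hfut hU hne h

/-- Row A2gn0 — «the reading of a scaling generator whose vertex time lies ON the measured slice
vanishes on a germ of that slice» ⇒ `u ≡ 0`.  EXCLUDED — PROVED, kinematic
(`eq_zero_of_genReading_onSlice`). -/
def Row_A2gn0 : Prop :=
  ∀ (C : ℝ) (u : ℝ → E3 → E3), IsTypeIAncientMild C u →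
    (∃ (a : E3) (σ τ t₁ : ℝ) (U : Set E3), t₁ < 0 ∧ σ ≠ 0 ∧ 2 * σ * t₁ + τ = 0 ∧
      IsOpen U ∧ U.Nonempty ∧ ∀ x ∈ U, genReading a σ τ u t₁ x = 0) →
    ∀ t < 0, ∀ x, u t x = 0

/-- **Row A2gn0 holds.** -/
theorem row_A2gn0 : Row_A2gn0 := by
  rintro C u hu ⟨a, σ, τ, t₁, U, ht₁, hσ, hon, hU, hne, h⟩
  exact eq_zero_of_genReading_onSlice hu ht₁ hσ hon hU hne h

/-- Row A2gnP — «the reading of a translation generator `a ≠ 0` vanishes on a germ of one slice»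
⇒ `u ≡ 0`.  EXCLUDED — PROVED from in-tree ingredients (`eq_zero_of_genReading_translation`: line
integration + `translationInvariant_of_germ` + census A13 BY NAME; the tree's `stub_shearRigidity`
(ClockCeiling) propagates a shear-free whole slice to all times) — not claimed new. -/
def Row_A2gnP : Prop :=
  ∀ (C : ℝ) (u : ℝ → E3 → E3), IsTypeIAncientMild C u →
    (∃ (a : E3) (t₁ : ℝ) (U : Set E3), a ≠ 0 ∧ t₁ < 0 ∧
      IsOpen U ∧ U.Nonempty ∧ ∀ x ∈ U, genReading a 0 0 u t₁ x = 0) →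
    ∀ t < 0, ∀ x, u t x = 0

/-- **Row A2gnP holds.** -/
theorem row_A2gnP : Row_A2gnP := by
  rintro C u hu ⟨a, t₁, U, ha, ht₁, hU, hne, h⟩
  exact eq_zero_of_genReading_translation hu ha ht₁ hU hne h

/-- Row A2gnE — «the reading of a scaling generator whose vertex time lies in the PAST of the measured
slice vanishes on a germ of that slice» ⇒ `u ≡ 0`.  OPEN (typed): the slice is a bounded EXPANDER
profile (`forwardProfile_of_scalingSlice`) and such profiles exist; no claim. -/
@[conjecture] def Row_A2gnE : Prop :=
  ∀ (C : ℝ) (u : ℝ → E3 → E3), IsTypeIAncientMild C u →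
    (∃ (a : E3) (σ τ t₁ : ℝ) (U : Set E3), t₁ < 0 ∧ σ ≠ 0 ∧ 0 < σ * (2 * σ * t₁ + τ) ∧
      IsOpen U ∧ U.Nonempty ∧ ∀ x ∈ U, genReading a σ τ u t₁ x = 0) →
    ∀ t < 0, ∀ x, u t x = 0

/-- Row A2gnTf — «a FROZEN instant: `∂ₜu(t₁, ·) = 0` on a germ of one slice (the drift generator
`(0, 0, τ)`, `τ ≠ 0`)» ⇒ `u ≡ 0`.  EXCLUDED IN THE TREE BY NAME (`SteadySliceLiouville`
⟨stmt-NavierStokesRegularity-10572⟩ / `openSetSteadyLiouville`; here `eq_zero_of_genReading_frozen`). -/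
def Row_A2gnTf : Prop :=
  ∀ (C : ℝ) (u : ℝ → E3 → E3), IsTypeIAncientMild C u →
    (∃ (τ t₁ : ℝ) (U : Set E3), τ ≠ 0 ∧ t₁ < 0 ∧
      IsOpen U ∧ U.Nonempty ∧ ∀ x ∈ U, genReading 0 0 τ u t₁ x = 0) →
    ∀ t < 0, ∀ x, u t x = 0

/-- **Row A2gnTf holds.** -/
theorem row_A2gnTf : Row_A2gnTf := by
  rintro C u hu ⟨τ, t₁, U, hτ, ht₁, hU, hne, h⟩
  exact eq_zero_of_genReading_frozen hu ht₁ hτ hU hne h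

/-- Row A2gnT — «a TRAVELLING instant: the reading of a drift generator `(a, 0, τ)` with `τ ≠ 0` AND
`a ≠ 0` vanishes on a germ of one slice (`D(u t₁)[a] + τ∂ₜu(t₁,·) = 0`: the Galilean boost with velocity
`τ⁻¹a` has a steady slice)» ⇒ `u ≡ 0`.  OPEN (typed): the slice is a bounded travelling-wave profile
(`travellingProfile_of_driftSlice`); the boost leaves Navier–Stokes invariant but NOT the class (no decay),
so the tree's steady-slice Liouville does not transfer; its SLAB version (a rigid co-motion on all `t < 0`)
is the tree's `stub_rigidComotionVanishing` (census A14).  No claim. -/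
@[conjecture] def Row_A2gnT : Prop :=
  ∀ (C : ℝ) (u : ℝ → E3 → E3), IsTypeIAncientMild C u →
    (∃ (a : E3) (τ t₁ : ℝ) (U : Set E3), a ≠ 0 ∧ τ ≠ 0 ∧ t₁ < 0 ∧
      IsOpen U ∧ U.Nonempty ∧ ∀ x ∈ U, genReading a 0 τ u t₁ x = 0) →
    ∀ t < 0, ∀ x, u t x = 0

/-- Row A2gn2 — «TWO NON-PROPORTIONAL generators of the parabolic algebra (`A = 0`; some `2 × 2` minor
nonzero) annihilate one germ of one slice» ⇒ `u ≡ 0`.  EXCLUDED — PROVED (`eq_zero_of_twoGenReadings`),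
for EVERY position of the two vertices — the RANK LAW `annihilator_rank_le_one`: a nonzero class element has
at most a one-dimensional one-slice isotropy, lying in the open cone (`annihilator_in_open_cone`). -/
def Row_A2gn2 : Prop :=
  ∀ (C : ℝ) (u : ℝ → E3 → E3), IsTypeIAncientMild C u →
    (∃ (a₁ a₂ : E3) (σ₁ σ₂ τ₁ τ₂ t₁ : ℝ) (U : Set E3), t₁ < 0 ∧ IsOpen U ∧ U.Nonempty ∧
      (σ₁ * τ₂ ≠ σ₂ * τ₁ ∨ σ₁ • a₂ ≠ σ₂ • a₁ ∨ τ₁ • a₂ ≠ τ₂ • a₁) ∧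
      (∀ x ∈ U, genReading a₁ σ₁ τ₁ u t₁ x = 0) ∧ ∀ x ∈ U, genReading a₂ σ₂ τ₂ u t₁ x = 0) →
    ∀ t < 0, ∀ x, u t x = 0

/-- **Row A2gn2 holds.** -/
theorem row_A2gn2 : Row_A2gn2 := by
  rintro C u hu ⟨a₁, a₂, σ₁, σ₂, τ₁, τ₂, t₁, U, ht₁, hU, hne, hmin, h₁, h₂⟩
  exact eq_zero_of_twoGenReadings hu ht₁ hU hne h₁ h₂ hmin

/-- Every row follows from (L′) «every Type-I ancient mild field vanishes». -/
theorem rows_of_L' (hL : ∀ (C : ℝ) (u : ℝ → E3 → E3), IsTypeIAncientMild C u → ∀ t < 0, ∀ x, u t x = 0) :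
    Row_A2gnS ∧ Row_A2gn0 ∧ Row_A2gnP ∧ Row_A2gnTf ∧ Row_A2gn2 ∧ Row_A2gnE ∧ Row_A2gnT :=
  ⟨fun C u hu _ => hL C u hu, fun C u hu _ => hL C u hu, fun C u hu _ => hL C u hu,
    fun C u hu _ => hL C u hu, fun C u hu _ => hL C u hu, fun C u hu _ => hL C u hu,
    fun C u hu _ => hL C u hu⟩

/-- **The rung decides every row**: the LADDER-NS rung (L′)
`Theses.SymmetryModuliCount.TypeIAncientLiouville` ⟨stmt-NavierStokesRegularity-10661⟩, BY NAME, implies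
every row of the generator meter (including the open `Row_A2gnE`, `Row_A2gnT`).  Nothing here proves the
rung.  No summit is proved by a line. -/
theorem rows_of_rung (hL : Theses.SymmetryModuliCount.TypeIAncientLiouville) :
    Row_A2gnS ∧ Row_A2gn0 ∧ Row_A2gnP ∧ Row_A2gnTf ∧ Row_A2gn2 ∧ Row_A2gnE ∧ Row_A2gnT :=
  rows_of_L' fun C u hu => hL C u (isTypeIAncientMild_iff.1 hu)

end Summit.NavierStokesRegularity.NavierStokesRegularity.Theorems.ScenarioCensus.GeneratorMeter

namespace Summit.NavierStokesRegularity.NavierStokesRegularity.Theorems.ScenarioCensus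

/-! ## Census KEYS (ns `…Theorems.ScenarioCensus`): instrument GENERATOR METER (block A2) — TREE-decided cells A2gnS / A2gn0 / A2gnP / A2gnTf / A2gn2, OPEN rows A2gnE / A2gnT -/

/-- **Cell A2gnS** (the reading of a SCALING generator with vertex time in the FUTURE of the measured slice vanishes on a germ ⇒ `u ≡ 0`; one-slice Tsai): `:= GeneratorMeter.Row_A2gnS`. DECIDED. -/
def Row_A2gnS : Prop := GeneratorMeter.Row_A2gnS
/-- A2gnS is EXCLUDED (decided in the tree): `GeneratorMeter.row_A2gnS`. -/
theorem row_A2gnS_excluded : Row_A2gnS := GeneratorMeter.row_A2gnS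

/-- **Cell A2gn0** (vertex time ON the measured slice ⇒ `u ≡ 0`; kinematic): `:= GeneratorMeter.Row_A2gn0`. DECIDED. -/
def Row_A2gn0 : Prop := GeneratorMeter.Row_A2gn0
/-- A2gn0 is EXCLUDED (decided in the tree): `GeneratorMeter.row_A2gn0`. -/
theorem row_A2gn0_excluded : Row_A2gn0 := GeneratorMeter.row_A2gn0

/-- **Cell A2gnP** (a TRANSLATION generator `a ≠ 0` annihilates a germ of one slice ⇒ `u ≡ 0`; census A13 BY NAME): `:= GeneratorMeter.Row_A2gnP`. DECIDED. -/
def Row_A2gnP : Prop := GeneratorMeter.Row_A2gnP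
/-- A2gnP is EXCLUDED (decided in the tree): `GeneratorMeter.row_A2gnP`. -/
theorem row_A2gnP_excluded : Row_A2gnP := GeneratorMeter.row_A2gnP

/-- **Cell A2gnTf** (a FROZEN instant: `∂ₜu(t₁, ·) = 0` on a germ ⇒ `u ≡ 0`; the tree's steady-slice Liouville in these coordinates): `:= GeneratorMeter.Row_A2gnTf`. DECIDED. -/
def Row_A2gnTf : Prop := GeneratorMeter.Row_A2gnTf
/-- A2gnTf is EXCLUDED (decided in the tree): `GeneratorMeter.row_A2gnTf`. -/
theorem row_A2gnTf_excluded : Row_A2gnTf := GeneratorMeter.row_A2gnTf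

/-- **Cell A2gn2** (TWO non-proportional generators annihilate one germ of one slice ⇒ `u ≡ 0`; the RANK LAW): `:= GeneratorMeter.Row_A2gn2`. DECIDED. -/
def Row_A2gn2 : Prop := GeneratorMeter.Row_A2gn2
/-- A2gn2 is EXCLUDED (decided in the tree): `GeneratorMeter.row_A2gn2`. -/
theorem row_A2gn2_excluded : Row_A2gn2 := GeneratorMeter.row_A2gn2

/-- **Row A2gnE** (EXPANDER instant: scaling generator with vertex time in the PAST of the slice) — typed only: `:= GeneratorMeter.Row_A2gnE`. OPEN. -/
@[conjecture] def Row_A2gnE : Prop := GeneratorMeter.Row_A2gnE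

/-- **Row A2gnT** (TRAVELLING instant: drift generator `(a, 0, τ)`, `a ≠ 0`, `τ ≠ 0`) — typed only (slab version = census A14): `:= GeneratorMeter.Row_A2gnT`. OPEN. -/
@[conjecture] def Row_A2gnT : Prop := GeneratorMeter.Row_A2gnT

end Summit.NavierStokesRegularity.NavierStokesRegularity.Theorems.ScenarioCensus

end
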